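import Literature.Probability.LatticeModels.SourcedDoubleCurrentsSwitchingProofs
import Literature.Probability.LatticeModels.CriticalUrsellFourFloor
import Literature.Probability.LatticeModels.CriticalFKIsingBoxCrossingLower
import Literature.Probability.LatticeModels.CriticalBlockMoments
import Literature.Probability.LatticeModels.HighDimPointwiseTriviality
import HarnessLib

/-!
# Crux `MergingFloor` (stmt-CriticalPhenomena-15592), line `xor-cluster-sign-bk`: the glue `stub_assembly`

Lead prover-line-stmt-CriticalPhenomena-15592-c1-0, 2026-08-17. Registered stub of the skeleton
`Cruxes/MergingFloor/Lines/xor_cluster_sign_bk.lean`: heart (SD) + disjoint-clusters BK + cluster cover +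
disphenoid symmetry ⟹ the crux (unfolded). Disphenoid `X_ε = ((0,0,0),(0,ε,1),(ε,ε,0),(ε,0,1))`, lattice
points `(0,0,0),(0,e,n),(e,e,0),(e,0,n)`, `e = ⌊ε/δ⌋`, `n = ⌊1/δ⌋`. Box level: `S₄,L² = P^{∅,∅}_L[𝓕_S]`
(ADC21 (3.7), `A = B = S`) `≤ P_L[(y₀↔y₁)∧𝓕_S] + P_L[03|12] + P_L[02|13] ≤ (3−2c)u_Lw_L + (G₀₃G₁₂)_L² + w_L²`;
`L → ∞`; `G₀₃G₁₂ = G₀₁G₂₃ =: u ≤ w := G₀₂G₁₃ ≤ S₄`, `0 < w` ⟹ `min c 1 · u ≤ 2u + w − S₄ = −U₄`.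
-/

noncomputable section

namespace Summit.CriticalPhenomena.Ising3DConformalLimit.ArmHyperscalingMergingFloorXor

open Literature.Probability.LatticeModels Literature.Probability.Percolation Filter Topology MeasureTheory
open scoped symmDiff

/-! ## The disphenoid and its lattice approximation -/
/-- The lattice approximation of `(a,b,c) ∈ ℝ³` is the coordinatewise floor. [folklore] -/
theorem latticeApprox_vec3 (δ a b c : ℝ) :
    latticeApprox δ (!₂[a, b, c] : EuclideanSpace ℝ (Fin 3)) = ![⌊a / δ⌋, ⌊b / δ⌋, ⌊c / δ⌋] := by
  funext i
  rw [latticeApprox_apply]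
  fin_cases i <;> simp

/-- The pinched disphenoid `X_ε = ((0,0,0),(0,ε,1),(ε,ε,0),(ε,0,1))` is non-coincident for `ε ≠ 0`.
[folklore] -/
theorem disphenoid_mem_nonCoincident {ε : ℝ} (hε : ε ≠ 0) :
    (![!₂[0, 0, 0], !₂[0, ε, 1], !₂[ε, ε, 0], !₂[ε, 0, 1]] : Fin 4 → EuclideanSpace ℝ (Fin 3)) ∈
      NonCoincident 3 4 := by
  intro i j h
  have h0 := congrArg (fun v : EuclideanSpace ℝ (Fin 3) => v 0) h
  have h1 := congrArg (fun v : EuclideanSpace ℝ (Fin 3) => v 1) h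
  have h2 := congrArg (fun v : EuclideanSpace ℝ (Fin 3) => v 2) h
  fin_cases i <;> fin_cases j <;> simp [hε, hε.symm] at h0 h1 h2 ⊢

/-- The lattice points of the disphenoid at mesh `δ`: `(0,0,0), (0,e,n), (e,e,0), (e,0,n)` with
`e = ⌊ε/δ⌋`, `n = ⌊1/δ⌋`. [folklore] -/
theorem latticeApprox_disphenoid (ε δ : ℝ) (i : Fin 4) :
    latticeApprox δ ((![!₂[0, 0, 0], !₂[0, ε, 1], !₂[ε, ε, 0], !₂[ε, 0, 1]] :
        Fin 4 → EuclideanSpace ℝ (Fin 3)) i) =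
      (![![0, 0, 0], ![0, ⌊ε / δ⌋, ⌊1 / δ⌋], ![⌊ε / δ⌋, ⌊ε / δ⌋, 0], ![⌊ε / δ⌋, 0, ⌊1 / δ⌋]] :
        Fin 4 → Site 3) i := by
  fin_cases i <;> simp [latticeApprox_vec3]

/-! ## Box-level bookkeeping -/
/-- `P^{∅,∅}_{Λ_L,β}` is a probability measure (`β ≥ 0`). [folklore] -/
theorem isProbabilityMeasure_sourceless (d L : ℕ) {β : ℝ} (hβ : 0 ≤ β) :
    IsProbabilityMeasure (sourcedDoubleCurrentLaw d L β ∅ ∅) := by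
  have h : currentSum (freeBoxGraph d L) β (boxSources d L ∅) ≠ 0 := by
    rw [boxSources_empty]
    exact (currentSum_empty_pos' (freeBoxGraph d L) β).ne'
  exact isProbabilityMeasure_sourcedDoubleCurrentLaw hβ h h

/-- **The XOR / cluster-sign identity in the box** (ADC21 (3.7) with `A = B = S`):
`P^{∅,∅}_{Λ_L,β}[𝓕_S] = (⟨σ_S⟩⁰_{Λ_L})²`. [cite: AizenmanDuminilCopinAnnals2021, eq. (3.7)] -/
theorem sourceless_real_traceSubcurrentEvent_eq_sq (d L : ℕ) {β : ℝ} (hβ : 0 ≤ β)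
    {S : Finset (Site d)} (hS : S ⊆ box d L) :
    (sourcedDoubleCurrentLaw d L β ∅ ∅).real (traceSubcurrentEvent S) =
      isingCorr (zdGraph d) (box d L) β 0 .free S ^ 2 := by
  have h := isingCorr_free_box_mul_eq d L hβ hS hS
  rw [symmDiff_self, Finset.bot_eq_empty, isingCorr_empty, one_mul] at h
  rw [sq, h]

/-- The image of `![y₀,y₁,y₂,y₃]` is the 4-set `{y₀,y₁,y₂,y₃}`. [folklore] -/
theorem image_vec4 {V : Type*} [DecidableEq V] (y0 y1 y2 y3 : V) :
    (Finset.univ.image (![y0, y1, y2, y3] : Fin 4 → V)) = {y0, y1, y2, y3} := by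
  ext v
  simp only [Finset.mem_image, Finset.mem_univ, true_and, Finset.mem_insert, Finset.mem_singleton]
  constructor
  · rintro ⟨i, rfl⟩
    fin_cases i <;> simp
  · rintro (rfl | rfl | rfl | rfl)
    exacts [⟨0, rfl⟩, ⟨1, rfl⟩, ⟨2, rfl⟩, ⟨3, rfl⟩]

/-- `![y₀,y₁,y₂,y₃]` is injective for pairwise distinct points. [folklore] -/
theorem injective_vec4 {V : Type*} {y0 y1 y2 y3 : V}
    (h01 : y0 ≠ y1) (h02 : y0 ≠ y2) (h03 : y0 ≠ y3) (h12 : y1 ≠ y2) (h13 : y1 ≠ y3) (h23 : y2 ≠ y3) :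
    Function.Injective (![y0, y1, y2, y3] : Fin 4 → V) := by
  intro i j hij
  fin_cases i <;> fin_cases j <;> simp at hij ⊢ <;>
    first
    | exact absurd hij h01
    | exact absurd hij h02
    | exact absurd hij h03
    | exact absurd hij h12
    | exact absurd hij h13
    | exact absurd hij h23
    | exact absurd hij.symm h01
    | exact absurd hij.symm h02
    | exact absurd hij.symm h03
    | exact absurd hij.symm h12
    | exact absurd hij.symm h13
    | exact absurd hij.symm h23

/-- The four-point spin monomial of distinct points is the correlation of the 4-set. [folklore] -/
theorem isingExpect_spinMonomial_four_eq_isingCorr {V : Type*} [DecidableEq V] (G : SimpleGraph V)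
    [G.LocallyFinite] (Λ : Finset V) (β h : ℝ) (bc : BoundaryCondition V) {y0 y1 y2 y3 : V}
    (h01 : y0 ≠ y1) (h02 : y0 ≠ y2) (h03 : y0 ≠ y3) (h12 : y1 ≠ y2) (h13 : y1 ≠ y3) (h23 : y2 ≠ y3) :
    isingExpect G Λ β h bc (spinMonomial ![y0, y1, y2, y3]) = isingCorr G Λ β h bc {y0, y1, y2, y3} := by
  rw [isingCorr, spinMonomial_of_injective_eq_spinProduct (injective_vec4 h01 h02 h03 h12 h13 h23),
    image_vec4]

/-- **The box chain.** For distinct `y₀,…,y₃ ∈ Λ_L` (`β ≥ 0`): the cluster cover and the BK inequality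
turn a bound `P^{∅,∅}_L[(y₀↔y₁)∧𝓕_S] ≤ K` into
`S₄,L² ≤ K + (G_L(y₀,y₃)G_L(y₁,y₂))² + (G_L(y₀,y₂)G_L(y₁,y₃))²`. [cite: AizenmanDuminilCopinAnnals2021, eq. (3.7)] -/
theorem box_chain {d L : ℕ} {β : ℝ} (hβ : 0 ≤ β)
    (hBK : ∀ (d L : ℕ) (β : ℝ), 0 ≤ β → ∀ a b c e : Site d,
      a ∈ box d L → b ∈ box d L → c ∈ box d L → e ∈ box d L →
      (sourcedDoubleCurrentLaw d L β ∅ ∅).real (openConn a c ∩ openConn b e ∩ (openConn a b)ᶜ) ≤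
        isingTwoPoint (zdGraph d) (box d L) β 0 .free a c ^ 2 *
          isingTwoPoint (zdGraph d) (box d L) β 0 .free b e ^ 2)
    (hCover : ∀ (d : ℕ) (ω : BondConfig (Site d)) (a b c e : Site d),
      a ≠ b → a ≠ c → a ≠ e → b ≠ c → b ≠ e → c ≠ e →
      ω ∈ traceSubcurrentEvent ({a, b, c, e} : Finset (Site d)) →
      ω ∈ openConn a b ∨ (ω ∈ openConn a c ∧ ω ∈ openConn b e) ∨ (ω ∈ openConn a e ∧ ω ∈ openConn b c))
    {y0 y1 y2 y3 : Site d} (hy0 : y0 ∈ box d L) (hy1 : y1 ∈ box d L) (hy2 : y2 ∈ box d L)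
    (hy3 : y3 ∈ box d L)
    (h01 : y0 ≠ y1) (h02 : y0 ≠ y2) (h03 : y0 ≠ y3) (h12 : y1 ≠ y2) (h13 : y1 ≠ y3) (h23 : y2 ≠ y3)
    {K : ℝ} (hK : (sourcedDoubleCurrentLaw d L β ∅ ∅).real
      (openConn y0 y1 ∩ traceSubcurrentEvent ({y0, y1, y2, y3} : Finset (Site d))) ≤ K) :
    isingExpect (zdGraph d) (box d L) β 0 .free (spinMonomial ![y0, y1, y2, y3]) ^ 2 ≤
      K + (isingTwoPoint (zdGraph d) (box d L) β 0 .free y0 y3 *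
            isingTwoPoint (zdGraph d) (box d L) β 0 .free y1 y2) ^ 2 +
        (isingTwoPoint (zdGraph d) (box d L) β 0 .free y0 y2 *
            isingTwoPoint (zdGraph d) (box d L) β 0 .free y1 y3) ^ 2 := by
  set P := sourcedDoubleCurrentLaw d L β ∅ ∅ with hP
  haveI : IsProbabilityMeasure P := isProbabilityMeasure_sourceless d L hβ
  set S : Finset (Site d) := {y0, y1, y2, y3} with hSdef
  have hS : S ⊆ box d L := by
    intro v hv
    simp only [hSdef, Finset.mem_insert, Finset.mem_singleton] at hv
    rcases hv with rfl | rfl | rfl | rfl <;> assumption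
  -- `S₄,L² = P[𝓕_S]`
  have hxor : isingExpect (zdGraph d) (box d L) β 0 .free (spinMonomial ![y0, y1, y2, y3]) ^ 2 =
      P.real (traceSubcurrentEvent S) := by
    rw [isingExpect_spinMonomial_four_eq_isingCorr _ _ _ _ _ h01 h02 h03 h12 h13 h23,
      sourceless_real_traceSubcurrentEvent_eq_sq d L hβ hS]
  -- the cluster cover
  have hcov : (traceSubcurrentEvent S : Set (BondConfig (Site d))) ⊆
      (openConn y0 y1 ∩ traceSubcurrentEvent S) ∪
        (openConn y0 y3 ∩ openConn y1 y2 ∩ (openConn y0 y1)ᶜ) ∪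
        (openConn y0 y2 ∩ openConn y1 y3 ∩ (openConn y0 y1)ᶜ) := by
    intro ω hω
    by_cases h : ω ∈ openConn y0 y1
    · exact Or.inl (Or.inl ⟨h, hω⟩)
    · rcases hCover d ω y0 y1 y2 y3 h01 h02 h03 h12 h13 h23 hω with h' | ⟨ha, hb⟩ | ⟨ha, hb⟩
      · exact absurd h' h
      · exact Or.inr ⟨⟨ha, hb⟩, h⟩
      · exact Or.inl (Or.inr ⟨⟨ha, hb⟩, h⟩)
  have hmono : P.real (traceSubcurrentEvent S) ≤
      P.real (openConn y0 y1 ∩ traceSubcurrentEvent S) +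
        P.real (openConn y0 y3 ∩ openConn y1 y2 ∩ (openConn y0 y1)ᶜ) +
        P.real (openConn y0 y2 ∩ openConn y1 y3 ∩ (openConn y0 y1)ᶜ) :=
    calc P.real (traceSubcurrentEvent S)
        ≤ P.real ((openConn y0 y1 ∩ traceSubcurrentEvent S) ∪
            (openConn y0 y3 ∩ openConn y1 y2 ∩ (openConn y0 y1)ᶜ) ∪
            (openConn y0 y2 ∩ openConn y1 y3 ∩ (openConn y0 y1)ᶜ)) := measureReal_mono hcov
      _ ≤ P.real ((openConn y0 y1 ∩ traceSubcurrentEvent S) ∪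
            (openConn y0 y3 ∩ openConn y1 y2 ∩ (openConn y0 y1)ᶜ)) +
            P.real (openConn y0 y2 ∩ openConn y1 y3 ∩ (openConn y0 y1)ᶜ) := measureReal_union_le _ _
      _ ≤ _ := by
        have := measureReal_union_le (μ := P) (openConn y0 y1 ∩ traceSubcurrentEvent S)
          (openConn y0 y3 ∩ openConn y1 y2 ∩ (openConn y0 y1)ᶜ)
        linarith
  -- the two BK bounds
  have hbk1 := hBK d L β hβ y0 y1 y3 y2 hy0 hy1 hy3 hy2
  have hbk2 := hBK d L β hβ y0 y1 y2 y3 hy0 hy1 hy2 hy3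
  rw [hxor]
  linarith

/-! ## Limit level: GKS, positivity, the algebra -/
/-- **GKS II at the tight pairing**: `G(y₀,y₂)G(y₁,y₃) ≤ S₄(y₀,y₁,y₂,y₃)` for distinct critical lattice
points (`criticalCorr_two_mul_two_le_four` on the relabelled tuple, `criticalCorr_comp_equiv_eq`).
[cite: FriedliVelenik2017, Thm. 3.20, eq. (3.22)] -/
theorem two02_mul_two13_le_four {y0 y1 y2 y3 : Site 3}
    (h01 : y0 ≠ y1) (h02 : y0 ≠ y2) (h03 : y0 ≠ y3) (h12 : y1 ≠ y2) (h13 : y1 ≠ y3) (h23 : y2 ≠ y3) :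
    criticalCorr 3 2 ![y0, y2] * criticalCorr 3 2 ![y1, y3] ≤ criticalCorr 3 4 ![y0, y1, y2, y3] := by
  have hinj : Function.Injective (![y0, y2, y1, y3] : Fin 4 → Site 3) :=
    injective_vec4 h02 h01 h03 h12.symm h23 h13
  have h := criticalCorr_two_mul_two_le_four (d := 3) le_rfl hinj
  have hperm : criticalCorr 3 4 ![y0, y2, y1, y3] = criticalCorr 3 4 ![y0, y1, y2, y3] := by
    have hcomp : (![y0, y1, y2, y3] : Fin 4 → Site 3) ∘ ⇑(Equiv.swap (1 : Fin 4) 2) = ![y0, y2, y1, y3] := by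
      funext i
      fin_cases i <;> simp [Equiv.swap_apply_of_ne_of_ne, Equiv.swap_apply_left, Equiv.swap_apply_right]
    rw [← hcomp, criticalCorr_comp_equiv_eq]
  simpa [hperm] using h

/-- The free box four-point function at `β_c` converges to the critical four-point correlator (`d = 3`).
[cite: FriedliVelenik2017, Thm. 3.17 and Exercise 3.16] -/
theorem tendsto_boxFourPoint (y : Fin 4 → Site 3) :
    Tendsto (fun L : ℕ => isingExpect (zdGraph 3) (box 3 L) (criticalBeta 3) 0 .free (spinMonomial y)) atTop
      (𝓝 (criticalCorr 3 4 y)) :=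
  criticalCorr_wellDefined_holds (d := 3) le_rfl 4 y .free (by simp)

/-- **The final algebra**: from `S₄² ≤ (3−2c)·u·w + u² + w²`, `u ≤ w ≤ S₄`, `0 < u`, `0 < w`, `0 < c`:
`min c 1 · u ≤ 2u + w − S₄` (positivity of `c` is not needed for this). [folklore] -/
theorem floor_algebra {S4 u w c : ℝ} (hu0 : 0 < u) (hw0 : 0 < w) (huw : u ≤ w) (hwS : w ≤ S4)
    (hlim : S4 ^ 2 ≤ (3 - 2 * c) * u * w + u ^ 2 + w ^ 2) :
    min c 1 * u ≤ 2 * u + w - S4 := by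
  set c' : ℝ := min c 1 with hc'def
  have hc'c : c' ≤ c := min_le_left _ _
  have hc'1 : c' ≤ 1 := min_le_right _ _
  have h1 : S4 ^ 2 ≤ (4 - 2 * c') * u * w + w ^ 2 := by nlinarith [mul_pos hu0 hw0]
  have hA : 0 ≤ (2 - c') * u * (S4 - w) := mul_nonneg (mul_nonneg (by linarith) hu0.le) (by linarith)
  have h2 : (S4 - w - (2 - c') * u) * (S4 + w) ≤ 0 * (S4 + w) := by nlinarith [h1, hA]
  have h3 : S4 - w - (2 - c') * u ≤ 0 := le_of_mul_le_mul_right h2 (by linarith)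
  linarith

/-- **The lattice inequality at one mesh.** From the eventual box bound
`P_L[(y₀↔y₁)∧𝓕_S] ≤ (3−2c)·(G_L(y₀,y₁)G_L(y₂,y₃))·(G_L(y₀,y₂)G_L(y₁,y₃))`, the BK inequality, the cluster
cover, the symmetry `G₀₁G₂₃ = G₀₃G₁₂` and MMS `G₀₁G₂₃ ≤ G₀₂G₁₃` at the critical state:
`min c 1 · G₀₁G₂₃ ≤ −U₄(y₀,y₁,y₂,y₃)`. [cite: AizenmanDuminilCopinAnnals2021, eq. (3.7)] -/
theorem lattice_floor
    (hBK : ∀ (d L : ℕ) (β : ℝ), 0 ≤ β → ∀ a b c e : Site d,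
      a ∈ box d L → b ∈ box d L → c ∈ box d L → e ∈ box d L →
      (sourcedDoubleCurrentLaw d L β ∅ ∅).real (openConn a c ∩ openConn b e ∩ (openConn a b)ᶜ) ≤
        isingTwoPoint (zdGraph d) (box d L) β 0 .free a c ^ 2 *
          isingTwoPoint (zdGraph d) (box d L) β 0 .free b e ^ 2)
    (hCover : ∀ (d : ℕ) (ω : BondConfig (Site d)) (a b c e : Site d),
      a ≠ b → a ≠ c → a ≠ e → b ≠ c → b ≠ e → c ≠ e →
      ω ∈ traceSubcurrentEvent ({a, b, c, e} : Finset (Site d)) →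
      ω ∈ openConn a b ∨ (ω ∈ openConn a c ∧ ω ∈ openConn b e) ∨ (ω ∈ openConn a e ∧ ω ∈ openConn b c))
    {y0 y1 y2 y3 : Site 3}
    (h01 : y0 ≠ y1) (h02 : y0 ≠ y2) (h03 : y0 ≠ y3) (h12 : y1 ≠ y2) (h13 : y1 ≠ y3) (h23 : y2 ≠ y3)
    (hu : criticalCorr 3 2 ![y0, y1] * criticalCorr 3 2 ![y2, y3] =
      criticalCorr 3 2 ![y0, y3] * criticalCorr 3 2 ![y1, y2])
    (huw : criticalCorr 3 2 ![y0, y1] * criticalCorr 3 2 ![y2, y3] ≤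
      criticalCorr 3 2 ![y0, y2] * criticalCorr 3 2 ![y1, y3])
    {c : ℝ}
    (hbox : ∀ᶠ L : ℕ in atTop,
      (sourcedDoubleCurrentLaw 3 L (criticalBeta 3) ∅ ∅).real
          (openConn y0 y1 ∩ traceSubcurrentEvent ({y0, y1, y2, y3} : Finset (Site 3))) ≤
        (3 - 2 * c) *
          (isingTwoPoint (zdGraph 3) (box 3 L) (criticalBeta 3) 0 .free y0 y1 *
            isingTwoPoint (zdGraph 3) (box 3 L) (criticalBeta 3) 0 .free y2 y3) *
          (isingTwoPoint (zdGraph 3) (box 3 L) (criticalBeta 3) 0 .free y0 y2 *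
            isingTwoPoint (zdGraph 3) (box 3 L) (criticalBeta 3) 0 .free y1 y3)) :
    min c 1 * (criticalCorr 3 2 ![y0, y1] * criticalCorr 3 2 ![y2, y3]) ≤
      -(criticalCorr 3 4 ![y0, y1, y2, y3] -
        (criticalCorr 3 2 ![y0, y1] * criticalCorr 3 2 ![y2, y3] +
          criticalCorr 3 2 ![y0, y2] * criticalCorr 3 2 ![y1, y3] +
          criticalCorr 3 2 ![y0, y3] * criticalCorr 3 2 ![y1, y2])) := by
  have hβ : 0 ≤ criticalBeta 3 := criticalBeta_nonneg 3
  -- eventual box membership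
  have hmem : ∀ᶠ L : ℕ in atTop, y0 ∈ box 3 L ∧ y1 ∈ box 3 L ∧ y2 ∈ box 3 L ∧ y3 ∈ box 3 L := by
    obtain ⟨L₀, hL₀⟩ := exists_forall_subset_box 3 ({y0, y1, y2, y3} : Finset (Site 3))
    filter_upwards [eventually_ge_atTop L₀] with L hL
    have hsub := hL₀ L hL
    refine ⟨hsub ?_, hsub ?_, hsub ?_, hsub ?_⟩ <;> simp
  -- the eventual box inequality
  have hev : ∀ᶠ L : ℕ in atTop,
      isingExpect (zdGraph 3) (box 3 L) (criticalBeta 3) 0 .free (spinMonomial ![y0, y1, y2, y3]) ^ 2 ≤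
      (3 - 2 * c) *
          (isingTwoPoint (zdGraph 3) (box 3 L) (criticalBeta 3) 0 .free y0 y1 *
            isingTwoPoint (zdGraph 3) (box 3 L) (criticalBeta 3) 0 .free y2 y3) *
          (isingTwoPoint (zdGraph 3) (box 3 L) (criticalBeta 3) 0 .free y0 y2 *
            isingTwoPoint (zdGraph 3) (box 3 L) (criticalBeta 3) 0 .free y1 y3) +
        (isingTwoPoint (zdGraph 3) (box 3 L) (criticalBeta 3) 0 .free y0 y3 *
            isingTwoPoint (zdGraph 3) (box 3 L) (criticalBeta 3) 0 .free y1 y2) ^ 2 +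
        (isingTwoPoint (zdGraph 3) (box 3 L) (criticalBeta 3) 0 .free y0 y2 *
            isingTwoPoint (zdGraph 3) (box 3 L) (criticalBeta 3) 0 .free y1 y3) ^ 2 := by
    filter_upwards [hbox, hmem] with L hL hLm
    exact box_chain hβ hBK hCover hLm.1 hLm.2.1 hLm.2.2.1 hLm.2.2.2 h01 h02 h03 h12 h13 h23 hL
  -- pass to the limit
  have hT : ∀ a b : Site 3, Tendsto (fun L : ℕ => isingTwoPoint (zdGraph 3) (box 3 L) (criticalBeta 3) 0 .free a b)
      atTop (𝓝 (criticalCorr 3 2 ![a, b])) := fun a b => by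
    have h := tendsto_isingTwoPoint_free_box (d := 3) hβ a b
    rwa [freeExpect_criticalBeta_spinMonomial le_rfl] at h
  have hpos : ∀ a b : Site 3, 0 < criticalCorr 3 2 ![a, b] := fun a b => by
    rw [criticalCorr_two_pair]; exact criticalTwoPoint_pos_of_three_le le_rfl _
  have hlim : criticalCorr 3 4 ![y0, y1, y2, y3] ^ 2 ≤
      (3 - 2 * c) * (criticalCorr 3 2 ![y0, y1] * criticalCorr 3 2 ![y2, y3]) *
          (criticalCorr 3 2 ![y0, y2] * criticalCorr 3 2 ![y1, y3]) +
        (criticalCorr 3 2 ![y0, y3] * criticalCorr 3 2 ![y1, y2]) ^ 2 +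
        (criticalCorr 3 2 ![y0, y2] * criticalCorr 3 2 ![y1, y3]) ^ 2 :=
    le_of_tendsto_of_tendsto ((tendsto_boxFourPoint ![y0, y1, y2, y3]).pow 2)
      ((((((hT y0 y1).mul (hT y2 y3)).const_mul (3 - 2 * c)).mul ((hT y0 y2).mul (hT y1 y3))).add
        (((hT y0 y3).mul (hT y1 y2)).pow 2)).add (((hT y0 y2).mul (hT y1 y3)).pow 2)) hev
  -- the algebra
  set g01 := criticalCorr 3 2 ![y0, y1] with hg01
  set g23 := criticalCorr 3 2 ![y2, y3] with hg23
  set g02 := criticalCorr 3 2 ![y0, y2] with hg02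
  set g13 := criticalCorr 3 2 ![y1, y3] with hg13
  set g03 := criticalCorr 3 2 ![y0, y3] with hg03
  set g12 := criticalCorr 3 2 ![y1, y2] with hg12
  set S4 := criticalCorr 3 4 ![y0, y1, y2, y3] with hS4
  have hu0 : 0 < g01 * g23 := mul_pos (hpos _ _) (hpos _ _)
  have hw0 : 0 < g02 * g13 := mul_pos (hpos _ _) (hpos _ _)
  have hwS : g02 * g13 ≤ S4 := two02_mul_two13_le_four h01 h02 h03 h12 h13 h23
  rw [hu] at hlim
  have hlim' : S4 ^ 2 ≤ (3 - 2 * c) * (g01 * g23) * (g02 * g13) + (g01 * g23) ^ 2 + (g02 * g13) ^ 2 := by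
    rw [hu]; exact hlim
  have key := floor_algebra (S4 := S4) (u := g01 * g23) (w := g02 * g13) (c := c) hu0 hw0 huw hwS (by nlinarith [hlim'])
  rw [← hu]
  linarith

/-! ## The registered glue stub -/
/-- **`stub_assembly` (registered glue stub of line `xor-cluster-sign-bk`)**: the heart (SD) at a pinched
disphenoid, the disjoint-clusters BK inequality for the sourceless double-current trace, the cluster cover
and the exact disphenoid symmetry + MMS imply the crux `MergingFloor` (stated unfolded): at
`x = X_ε ∈ NonCoincident 3 4` with constant `min c 1`, for all small `δ`,
`min c 1 · ⟨σσ⟩₀₁⟨σσ⟩₂₃ ≤ −U₄^{lat}([x/δ])`. [cite: AizenmanDuminilCopinAnnals2021, eq. (3.7)] -/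
theorem stub_assembly :
    (∃ ε : ℝ, 0 < ε ∧ ε < 1 ∧ ∃ c : ℝ, 0 < c ∧
      ∀ᶠ δ in 𝓝[>] (0:ℝ), ∀ᶠ L : ℕ in atTop,
        (sourcedDoubleCurrentLaw 3 L (criticalBeta 3) ∅ ∅).real
            (openConn (![0, 0, 0] : Site 3) ![0, ⌊ε / δ⌋, ⌊1 / δ⌋] ∩
              traceSubcurrentEvent ({![0, 0, 0], ![0, ⌊ε / δ⌋, ⌊1 / δ⌋], ![⌊ε / δ⌋, ⌊ε / δ⌋, 0],
                ![⌊ε / δ⌋, 0, ⌊1 / δ⌋]} : Finset (Site 3))) ≤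
          (3 - 2 * c) *
            (isingTwoPoint (zdGraph 3) (box 3 L) (criticalBeta 3) 0 .free ![0, 0, 0] ![0, ⌊ε / δ⌋, ⌊1 / δ⌋] *
              isingTwoPoint (zdGraph 3) (box 3 L) (criticalBeta 3) 0 .free ![⌊ε / δ⌋, ⌊ε / δ⌋, 0] ![⌊ε / δ⌋, 0, ⌊1 / δ⌋]) *
            (isingTwoPoint (zdGraph 3) (box 3 L) (criticalBeta 3) 0 .free ![0, 0, 0] ![⌊ε / δ⌋, ⌊ε / δ⌋, 0] *
              isingTwoPoint (zdGraph 3) (box 3 L) (criticalBeta 3) 0 .free ![0, ⌊ε / δ⌋, ⌊1 / δ⌋] ![⌊ε / δ⌋, 0, ⌊1 / δ⌋])) →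
    (∀ (d L : ℕ) (β : ℝ), 0 ≤ β → ∀ a b c e : Site d,
      a ∈ box d L → b ∈ box d L → c ∈ box d L → e ∈ box d L →
      (sourcedDoubleCurrentLaw d L β ∅ ∅).real (openConn a c ∩ openConn b e ∩ (openConn a b)ᶜ) ≤
        isingTwoPoint (zdGraph d) (box d L) β 0 .free a c ^ 2 *
          isingTwoPoint (zdGraph d) (box d L) β 0 .free b e ^ 2) →
    (∀ (d : ℕ) (ω : BondConfig (Site d)) (a b c e : Site d),
      a ≠ b → a ≠ c → a ≠ e → b ≠ c → b ≠ e → c ≠ e →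
      ω ∈ traceSubcurrentEvent ({a, b, c, e} : Finset (Site d)) →
      ω ∈ openConn a b ∨ (ω ∈ openConn a c ∧ ω ∈ openConn b e) ∨ (ω ∈ openConn a e ∧ ω ∈ openConn b c)) →
    (∀ (e n : ℤ), 0 ≤ e → e ≤ n →
      criticalCorr 3 2 ![![0, 0, 0], ![0, e, n]] * criticalCorr 3 2 ![![e, e, 0], ![e, 0, n]] =
        criticalCorr 3 2 ![![0, 0, 0], ![e, 0, n]] * criticalCorr 3 2 ![![0, e, n], ![e, e, 0]] ∧
      criticalCorr 3 2 ![![0, 0, 0], ![0, e, n]] * criticalCorr 3 2 ![![e, e, 0], ![e, 0, n]] ≤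
        criticalCorr 3 2 ![![0, 0, 0], ![e, e, 0]] * criticalCorr 3 2 ![![0, e, n], ![e, 0, n]]) →
    (∃ x ∈ NonCoincident 3 4, ∃ c : ℝ, 0 < c ∧ ∀ᶠ δ in nhdsWithin (0:ℝ) (Set.Ioi 0),
      c * (criticalCorr 3 2 ![latticeApprox δ (x 0), latticeApprox δ (x 1)] *
        criticalCorr 3 2 ![latticeApprox δ (x 2), latticeApprox δ (x 3)]) ≤
      -(criticalCorr 3 4 (fun i => latticeApprox δ (x i)) -
        (criticalCorr 3 2 ![latticeApprox δ (x 0), latticeApprox δ (x 1)] *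
            criticalCorr 3 2 ![latticeApprox δ (x 2), latticeApprox δ (x 3)] +
          criticalCorr 3 2 ![latticeApprox δ (x 0), latticeApprox δ (x 2)] *
            criticalCorr 3 2 ![latticeApprox δ (x 1), latticeApprox δ (x 3)] +
          criticalCorr 3 2 ![latticeApprox δ (x 0), latticeApprox δ (x 3)] *
            criticalCorr 3 2 ![latticeApprox δ (x 1), latticeApprox δ (x 2)]))) := by
  intro hSD hBK hCover hSym
  obtain ⟨ε, hε0, hε1, c, hc, hev⟩ := hSD
  refine ⟨![!₂[0, 0, 0], !₂[0, ε, 1], !₂[ε, ε, 0], !₂[ε, 0, 1]], disphenoid_mem_nonCoincident hε0.ne',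
    min c 1, lt_min hc one_pos, ?_⟩
  filter_upwards [hev, Ioo_mem_nhdsGT hε0] with δ hδL hδ
  obtain ⟨hδ0, hδε⟩ := hδ
  -- the lattice points
  have hfun : (fun i => latticeApprox δ ((![!₂[0, 0, 0], !₂[0, ε, 1], !₂[ε, ε, 0], !₂[ε, 0, 1]] :
      Fin 4 → EuclideanSpace ℝ (Fin 3)) i)) =
      ![![0, 0, 0], ![0, ⌊ε / δ⌋, ⌊1 / δ⌋], ![⌊ε / δ⌋, ⌊ε / δ⌋, 0], ![⌊ε / δ⌋, 0, ⌊1 / δ⌋]] :=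
    funext (latticeApprox_disphenoid ε δ)
  have h0 : latticeApprox δ ((![!₂[0, 0, 0], !₂[0, ε, 1], !₂[ε, ε, 0], !₂[ε, 0, 1]] :
      Fin 4 → EuclideanSpace ℝ (Fin 3)) 0) = ![0, 0, 0] := latticeApprox_disphenoid ε δ 0
  have h1 : latticeApprox δ ((![!₂[0, 0, 0], !₂[0, ε, 1], !₂[ε, ε, 0], !₂[ε, 0, 1]] :
      Fin 4 → EuclideanSpace ℝ (Fin 3)) 1) = ![0, ⌊ε / δ⌋, ⌊1 / δ⌋] := latticeApprox_disphenoid ε δ 1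
  have h2 : latticeApprox δ ((![!₂[0, 0, 0], !₂[0, ε, 1], !₂[ε, ε, 0], !₂[ε, 0, 1]] :
      Fin 4 → EuclideanSpace ℝ (Fin 3)) 2) = ![⌊ε / δ⌋, ⌊ε / δ⌋, 0] := latticeApprox_disphenoid ε δ 2
  have h3 : latticeApprox δ ((![!₂[0, 0, 0], !₂[0, ε, 1], !₂[ε, ε, 0], !₂[ε, 0, 1]] :
      Fin 4 → EuclideanSpace ℝ (Fin 3)) 3) = ![⌊ε / δ⌋, 0, ⌊1 / δ⌋] := latticeApprox_disphenoid ε δ 3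
  rw [hfun, h0, h1, h2, h3]
  -- integer bookkeeping: `1 ≤ e ≤ n`
  set e : ℤ := ⌊ε / δ⌋ with he
  set n : ℤ := ⌊1 / δ⌋ with hn
  have he1 : 1 ≤ e := by
    rw [he, Int.le_floor, Int.cast_one]
    exact (one_le_div hδ0).2 hδε.le
  have hen : e ≤ n := Int.floor_le_floor (div_le_div_of_nonneg_right hε1.le hδ0.le)
  have hn1 : 1 ≤ n := he1.trans hen
  have he0 : 0 ≤ e := zero_le_one.trans he1
  have hene : (e : ℤ) ≠ 0 := by omega
  have hnne : (n : ℤ) ≠ 0 := by omega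
  -- distinctness of the four lattice points
  have h01 : (![0, 0, 0] : Site 3) ≠ ![0, e, n] := fun h => hnne (by have := congrFun h 2; simpa using this.symm)
  have h02 : (![0, 0, 0] : Site 3) ≠ ![e, e, 0] := fun h => hene (by have := congrFun h 0; simpa using this.symm)
  have h03 : (![0, 0, 0] : Site 3) ≠ ![e, 0, n] := fun h => hene (by have := congrFun h 0; simpa using this.symm)
  have h12 : (![0, e, n] : Site 3) ≠ ![e, e, 0] := fun h => hene (by have := congrFun h 0; simpa using this.symm)
  have h13 : (![0, e, n] : Site 3) ≠ ![e, 0, n] := fun h => hene (by have := congrFun h 0; simpa using this.symm)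
  have h23 : (![e, e, 0] : Site 3) ≠ ![e, 0, n] := fun h => hene (by have := congrFun h 1; simpa using this)
  -- symmetry and MMS
  obtain ⟨hu, huw⟩ := hSym e n he0 hen
  exact lattice_floor hBK hCover h01 h02 h03 h12 h13 h23 hu huw hδL

end Summit.CriticalPhenomena.Ising3DConformalLimit.ArmHyperscalingMergingFloorXor
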